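import Literature.Analysis.FluidPDE.SawtoothCascade
import Literature.Analysis.FluidPDE.SawtoothCascadeDriftFree
import Literature.Analysis.FluidPDE.AnomalousDissipation
import Literature.Analysis.FluidPDE.TwoHalfNavierStokes
import Literature.Analysis.FluidPDE.PassiveVector
import Literature.Analysis.FluidPDE.PassiveScalar
import HarnessLib
import HarnessLib.Audit
import Summits.AnomalousDissipation.AnomalousDissipation.Statement
import Summits.AnomalousDissipation.AnomalousDissipation.Theses.SawtoothPulseCascade
import Summits.AnomalousDissipation.AnomalousDissipation.Theorems.SawtoothPulseCascadeK3NonlinearClosureStubPackaging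
import Summits.AnomalousDissipation.AnomalousDissipation.Theorems.SawtoothPulseCascadeK3NonlinearClosureStubScalarVelocityStability
import Summits.AnomalousDissipation.AnomalousDissipation.Theorems.SawtoothPulseCascadeK3NonlinearClosureStubShearGradientEnvelope
import Summits.AnomalousDissipation.AnomalousDissipation.Theorems.SawtoothPulseCascadeK3NonlinearClosureStubLocalisedClosure
import Summits.AnomalousDissipation.AnomalousDissipation.Theorems.SawtoothPulseCascadeK3NonlinearClosureStubHalfPulseEnergyBound
import Summits.AnomalousDissipation.AnomalousDissipation.Theorems.SawtoothPulseCascadeK3NonlinearClosureK1Window58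

/-! # SawtoothPulseCascade — second registered line for crux `K3NonlinearClosure` (K3′):
THE LOCALISED CLOSURE (ad-ideate-p2 gen 4, ROUND-3).

RESHAPE r1 (leafhand-ad-sawtoothpulsecasca-2 g0, 2026-08-30; NO re-planning — same five stubs, same composition):
the packaging layer (`planarForce`, `liftedForce`, `liftedDatum`, `ConstructionRegular`, `PlanarAnomalousFamily`,
`LiftClassical`, `Existence`) and `Jrate` / `K1Localised` / `K1FixedFraction_of_K1Localised` are now CITED from the
tree (`Literature.Analysis.FluidPDE.SawtoothCascade.DriftFree.*`, p-landed `SawtoothCascadeDriftFree`;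
`SawtoothCascade` Part 8), where they were landed VERBATIM after this line was registered, and the local
abbreviation `boxP γ ρN` is unfolded to `⟨γ, 1 / 4, 2, 1, ρN⟩` in the stub signatures — so that stub proofs under
`Theorems/` can state the registered signatures in tree vocabulary without a definitions file.  The remaining
local predicates (`ClosureWindow`, `ScalarVelocityStability`, `ShearGradientEnvelope`, `PlanarSlaving`,
`K1LocalisedInWindow`, `PlanarSlavingInWindow`) are unchanged; the closed `HalfPulseEnergyBound` is now spelled
`∀ P, HalfPulseEnergyBound P` over the tree's per-parameter `DriftFree.HalfPulseEnergyBound` (definitionally equal).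
RESHAPE r7 (same seat): S3/S4 restricted to the sub-box `γ ∈ [5,8]` actually consumed and spelled out in tree vocabulary, glue point moved `(4,2) → (5,2)`; S3 is now EXACTLY crux K1loc (19491) through the landed window reduction `k1LocalisedInWindow58_of_cruxRate` (p795336) — see `stub_k1Localised_of_K1LocalisedCascade`; 2 sorries (S3 = 19491-on-[5,8], S4 crux-sized).
STATE r6 (leafhand-ad-sawtoothpulsecasca-2 g1, 2026-08-31): S2c `stub_halfPulseEnergyBound` LANDED p799028 (`Theorems/…StubHalfPulseEnergyBound.lean`, via the ν-uniform weak-class energy inequality with production `…WeakEnergyGrowth.lean` p798498 + Leray reduction of the datum + the shear production bound); 2 sorries left: S3 `stub_k1Localised` (crux 19491-sized), S4 `stub_planarSlaving` (crux-sized).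
STATE r5 (same seat): S5 LANDED p795074 (via LEMMA X `approximateSolution_of_planarSlaving` p794951 + the landed drift-free closure); 3 sorries left: S2c `stub_halfPulseEnergyBound`, S3 `stub_k1Localised`, S4 `stub_planarSlaving`.
RESHAPE r4 (same seat): S5 `stub_localisedClosure` restated per parameter point in tree vocabulary without the (landed) toolkit hypotheses; composition instantiates the box corner (4,2).
STATE r3 (same seat): S1, S2a, S2b LANDED and cited below (4 sorries left: S2c, S3, S4, S5); `ClosureWindow` holds on the whole box — helper `K3NonlinearClosureLocalised.closureWindow48` (Theorems/…ClosureWindow48.lean).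
RESHAPE r2 (same seat): the conjunction stub `stub_toolkit` (three independent lemmas of sizes S / M / XL) is
split into its three conjuncts `stub_scalarVelocityStability`, `stub_shearGradientEnvelope`,
`stub_halfPulseEnergyBound`, each stated in tree vocabulary (the first two with the predicate body spelled out,
so that they can land by name; the third over `DriftFree.HalfPulseEnergyBound`); 7 stubs ≤ stubs_max, the
composition `K3NonlinearClosure_of` is unchanged up to this unpacking.

Finding of the gen-4 closure audit (ROUND-3 §1–§3): the ROUND-2 §2.1 scalar-cost budget cannot be run on all of
`[0,1]` — after the dissipation phase `J(ν)` the planar perturbation keeps growing at the residual scales and the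
cascade scalar's straggler gradients keep being stretched, so `∫_{T(ν)}^1 ‖V_ν − ū‖‖∇θ^ū‖_∞` is not small.  The budget
closes when LOCALISED to `t ≤ T(ν) := tStart (J_r(ν) + A)`, `J_r(ν) = ⌈log(1/ν)/(2 log r)⌉`, provided
  (i)  a fixed fraction of the cascade scalar's variance is dissipated BY `T(κ)` (`K1Localised P r`, a localised and
       therefore STRONGER form of the route's K1; `K1FixedFraction_of_K1Localised` below), with `r = γ² − 2`;
  (ii) the planar Navier–Stokes solution stays slaved to `ū` up to phase `J_r(ν) + A` with the K2″ rate
       (`PlanarSlaving`, from K2″ + the crude half-pulse energy bound by a Duhamel/bootstrap argument);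
  (iii) the closure inequality `max(ρN, 3e^{σ⋆γ})·(γ²+2) < (γ²−2)²` (`ClosureWindow`; on the box the binding
       corner is γ = 4: 186.5 < 196), where `γ² + 2 ≥ ‖B(γ)‖` bounds the per-phase growth of `‖∇θ^ū‖_∞`
       (`ShearGradientEnvelope`, a maximum-principle lemma) and the cost is converted into dissipation by the
       `L²`-stability of scalar transport under a drift perturbation (`ScalarVelocityStability`).
After `T(ν)` NOTHING about the planar flow is needed: `ν∫‖∇u_ν‖² ≥ ν∫₀^{T(ν)}‖∇θ_ν‖²`.
Stubs: S1 packaging (M) · S2 toolkit of three provable-now lemmas (M each) · S3 `K1LocalisedInWindow` (XL, the real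
K1: K1loc with a rate inside the window) · S4 `PlanarSlavingInWindow` (XL, consumes K2″) · S5 the localised closure
bookkeeping (L); `ClosureWindow` (provable now) certifies that the pessimistic rate r = γ² − 2 is admissible.  Composition `K3NonlinearClosure_of`
is kernel-checked; it ignores the hypothesis `K1BoundedStrainCascade` of K3′ (implied by S3, not used). -/

-- `Summit.<Summit>.<Problem>`: single-conjunct summit, the duplicate namespace segment is deliberate.
set_option linter.dupNamespace false

namespace Summit.AnomalousDissipation.AnomalousDissipation.Cruxes.K3NonlinearClosure.Localised

open scoped InnerProductSpace ENNReal NNReal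
open MeasureTheory Set Filter
open Literature.Analysis Literature.Analysis.FunctionSpaces Literature.Analysis.FluidPDE
open Literature.Analysis.FluidPDE.SawtoothCascade
open Literature.Analysis.FluidPDE.SawtoothCascade.DriftFree
  (planarForce liftedForce liftedDatum ConstructionRegular PlanarAnomalousFamily LiftClassical Existence
    HalfPulseEnergyBound)
open Literature.Analysis.FunctionSpaces.Torus (twoHalf planarProj)
open Summit.AnomalousDissipation.AnomalousDissipation.Theses.SawtoothPulseCascade

/-! ## The gen-3 packaging layer is the tree's `SawtoothCascade.DriftFree` (opened above): `planarForce`,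
`liftedForce`, `liftedDatum`, `ConstructionRegular`, `PlanarAnomalousFamily`, `LiftClassical`, `Existence`. -/

/-! ## The localised layer (gen 4). -/

/-! `Jrate`, `K1Localised`, `eScalarDissipation_mono_right`, `K1FixedFraction_of_K1Localised` are the tree's
(`SawtoothCascade` Part 8, namespace `Literature.Analysis.FluidPDE.SawtoothCascade`, opened above). -/

/-- The closure inequality on the box: per-phase (K2″ cap ∨ frequency ratio) × sup-gradient envelope < (bulk rate)².
Binding at `γ = 4`: `max(7, 3e^{1.23928})·18 = 186.5 < 196`. Provable now (calculus / interval arithmetic). -/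
def ClosureWindow : Prop :=
  ∀ γ ∈ Icc (4 : ℝ) 8, ∀ ρN : ℕ, ρN ∈ Finset.Icc 2 7 →
    max (ρN : ℝ) (3 * Real.exp (sawSigmaStar * γ)) * (γ ^ 2 + 2) < (γ ^ 2 - 2) ^ 2

/-- `L²`-stability of classical scalar transport under a drift perturbation (energy estimate for the difference
`η = ζ − θ`: `∂ₜη + v·∇η − κΔη = −(v−u)·∇θ`, so `‖η(T)‖ ≤ ∫₀ᵀ ‖v−u‖_{L²} ‖∇θ‖_∞` and
`|‖θ(T)‖² − ‖ζ(T)‖²| ≤ ‖η(T)‖ (‖θ(T)‖ + ‖ζ(T)‖) ≤ 2‖θ₀‖ ‖η(T)‖`). Provable now. -/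
def ScalarVelocityStability : Prop :=
  ∀ (S : Set ℝ) (κ T : ℝ) (u v : ℝ → UnitAddTorus (Fin 2) → EuclideanSpace ℝ (Fin 2))
    (θ ζ : ℝ → UnitAddTorus (Fin 2) → ℝ) (G : ℝ → ℝ),
    0 ≤ κ → 0 ≤ T → Convex ℝ S → Icc 0 T ⊆ S →
    FluidPDE.Torus.IsClassicalScalarTransportOn S κ u θ → FluidPDE.Torus.IsClassicalScalarTransportOn S κ v ζ →
    θ 0 = ζ 0 →
    (∀ t ∈ Icc 0 T, ∀ x, ‖FunctionSpaces.Torus.gradient (θ t) x‖ ≤ G t) →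
    IntervalIntegrable (fun t => Real.sqrt (FluidPDE.Torus.vectorL2Sq (u t - v t)) * G t) volume 0 T →
    |FluidPDE.Torus.scalarL2Sq (θ T) - FluidPDE.Torus.scalarL2Sq (ζ T)| ≤
      2 * Real.sqrt (FluidPDE.Torus.scalarL2Sq (θ 0)) *
        ∫ t in (0 : ℝ)..T, Real.sqrt (FluidPDE.Torus.vectorL2Sq (u t - v t)) * G t

/-- Sup-gradient envelope across one pulse of the cascade (maximum principle for `∂_∥θ`, Duhamel + maximum
principle for `∂_⊥θ`, using `|∂U_j| ≤ 1` and total strain `γ`): H pulse of phase `j` on `[tStart j, tStart j + tHalf j]`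
(velocity along `e₀`, profile in coordinate `1`) and V pulse on `[tStart j + tHalf j, tStart (j+1)]`.  Iterating,
`‖∇θ(tStart j)‖_∞ ≤ √2 ‖B(γ)‖^j ‖∇θ₀‖_∞` with `‖B(γ)‖ < γ² + 2`.  Provable now (given the field's structure). -/
def ShearGradientEnvelope : Prop :=
  ∀ (P : CascadeParams) (κ : ℝ) (j : ℕ) (S : Set ℝ) (w : ℝ → UnitAddTorus (Fin 2) → ℝ),
    0 ≤ κ → 0 ≤ P.γ → 0 < P.δ₀ → 1 ≤ P.d → Convex ℝ S →
    Icc (CascadeParams.tStart j) (CascadeParams.tStart (j + 1)) ⊆ S →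
    FluidPDE.Torus.IsClassicalScalarTransportOn S κ P.field w →
    ((⨆ x, |FunctionSpaces.Torus.gradient (w (CascadeParams.tStart j + CascadeParams.tHalf j)) x 0|) ≤
        ⨆ x, |FunctionSpaces.Torus.gradient (w (CascadeParams.tStart j)) x 0|) ∧
    ((⨆ x, |FunctionSpaces.Torus.gradient (w (CascadeParams.tStart j + CascadeParams.tHalf j)) x 1|) ≤
        (⨆ x, |FunctionSpaces.Torus.gradient (w (CascadeParams.tStart j)) x 1|) +
          P.γ * ⨆ x, |FunctionSpaces.Torus.gradient (w (CascadeParams.tStart j)) x 0|) ∧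
    ((⨆ x, |FunctionSpaces.Torus.gradient (w (CascadeParams.tStart (j + 1))) x 1|) ≤
        ⨆ x, |FunctionSpaces.Torus.gradient (w (CascadeParams.tStart j + CascadeParams.tHalf j)) x 1|) ∧
    ((⨆ x, |FunctionSpaces.Torus.gradient (w (CascadeParams.tStart (j + 1))) x 0|) ≤
        (⨆ x, |FunctionSpaces.Torus.gradient (w (CascadeParams.tStart j + CascadeParams.tHalf j)) x 0|) +
          P.γ * ⨆ x, |FunctionSpaces.Torus.gradient (w (CascadeParams.tStart j + CascadeParams.tHalf j)) x 1|)

/-! The crude half-pulse energy bound is the tree's per-parameter `DriftFree.HalfPulseEnergyBound P`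
(`SawtoothCascadeDriftFree`); the line's closed form is `∀ P, HalfPulseEnergyBound P`. -/

/-- PLANAR SLAVING up to the horizon `J_r(ν) + A` (every fixed `A`, ν small): the classical planar Navier–Stokes
solution forced by `∂ₜū` from rest stays within `K ν Σ_{i≤j} (N_i/√δ_i) M^{j−i}` of `ū` in velocity `L²` on phase
`j`, `M = max(ρN, 3e^{σ⋆γ})` — `ν N_i δ_i^{-1/2}` is the `L²` scale of the rounded-corner residual `νΔū` integrated over
pulse `i` (`‖S_δ″‖_{L²} ≍ δ^{-1/2}`).  Mechanism: exact perturbation equation for `W = V − ū` (forcing `νΔū`, an odd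
`N_i`-comb parallel to the running pulse, hence heat-evolved exactly until the pulse ends), Duhamel superposition of
K2″ over these comb-class injections re-aligned to `tInject` by backward heat over ≤ one half pulse (legitimate while
`8π²νN_i²tHalf i < δ_i²`, i.e. up to the horizon when `2ρN ≤ r`), and the nonlinear source `(W·∇)W` closed by a
bootstrap with the general-data bound `HalfPulseEnergyBound` (its relative size is `≲ ν(M‖B‖)^j → 0` inside the window). -/
def PlanarSlaving (P : CascadeParams) (r : ℝ) : Prop :=
  ∀ A : ℕ, ∃ ν₀ : ℝ, 0 < ν₀ ∧ ∃ K : ℝ, ∀ ν ∈ Ioc 0 ν₀,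
    ∀ (V : ℝ → UnitAddTorus (Fin 2) → EuclideanSpace ℝ (Fin 2)) (φ : ℝ → UnitAddTorus (Fin 2) → ℝ),
      FunctionSpaces.Torus.IsClassicalNSSolutionOn (Ico (0 : ℝ) 1) ν (planarForce P) V φ → V 0 = 0 →
      ∀ j ≤ Jrate r ν + A, ∀ t ∈ Icc (CascadeParams.tStart j) (CascadeParams.tStart (j + 1)),
        Real.sqrt (FluidPDE.Torus.vectorL2Sq (V t - P.field t)) ≤
          K * ν * ∑ i ∈ Finset.range (j + 1),
            (P.N i : ℝ) / Real.sqrt (P.δ i) * (max (P.ρN : ℝ) (3 * Real.exp (sawSigmaStar * P.γ))) ^ (j - i)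

/-! ## Registered stubs. -/

/-- The S3 statement: on the box, K1loc holds with SOME rate `r > 1` inside the closure window
`max(ρN, 3e^{σ⋆γ})·(γ² + 2) < r²` (the window couples the scalar's cascade rate to the K2″ cap and the envelope). -/
def K1LocalisedInWindow : Prop :=
  ∀ γ ∈ Icc (4 : ℝ) 8, ∀ ρN : ℕ, ρN ∈ Finset.Icc 2 7 → ∃ r : ℝ, 1 < r ∧
    max (ρN : ℝ) (3 * Real.exp (sawSigmaStar * γ)) * (γ ^ 2 + 2) < r ^ 2 ∧ K1Localised ⟨γ, 1 / 4, 2, 1, ρN⟩ r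

/-- The S4 conclusion: planar slaving up to the horizon of every admissible rate. -/
def PlanarSlavingInWindow : Prop :=
  ∀ γ ∈ Icc (4 : ℝ) 8, ∀ ρN : ℕ, ρN ∈ Finset.Icc 2 7 → ∀ r : ℝ, 1 < r →
    max (ρN : ℝ) (3 * Real.exp (sawSigmaStar * γ)) * (γ ^ 2 + 2) < r ^ 2 → PlanarSlaving ⟨γ, 1 / 4, 2, 1, ρN⟩ r

/-- How the pessimistic bulk rate `r = γ² − 2` feeds S3: `ClosureWindow` certifies it lies in the window on the
whole box (no sorry). -/
theorem k1LocalisedInWindow_of_pessimisticRate (hw : ClosureWindow)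
    (h : ∀ γ ∈ Icc (4 : ℝ) 8, ∀ ρN ∈ Finset.Icc 2 7, K1Localised ⟨γ, 1 / 4, 2, 1, ρN⟩ (γ ^ 2 - 2)) :
    K1LocalisedInWindow := by
  intro γ hγ ρN hρ
  refine ⟨γ ^ 2 - 2, ?_, hw γ hγ ρN hρ, h γ hγ ρN hρ⟩
  have : (4 : ℝ) ≤ γ := hγ.1
  nlinarith

/-- STUB S1 (M): packaging — regularity of the explicit force/datum, the classical 2½-D lift, existence for fixed ν.
LANDED (p793731, `Theorems/SawtoothPulseCascadeK3NonlinearClosureStubPackaging.lean`): cited, no longer a sorry. -/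
theorem stub_packaging :
    (∀ γ ∈ Icc (4 : ℝ) 8, ∀ ρN ∈ Finset.Icc 2 7, ConstructionRegular ⟨γ, 1 / 4, 2, 1, ρN⟩) ∧ LiftClassical ∧
    (∀ γ ∈ Icc (4 : ℝ) 8, ∀ ρN ∈ Finset.Icc 2 7, Existence ⟨γ, 1 / 4, 2, 1, ρN⟩) :=
  Summit.AnomalousDissipation.AnomalousDissipation.Theorems.SawtoothPulseCascade.K3NonlinearClosureLocalised.stub_packaging

/-- STUB S2a (S) — LANDED p794233 (`Theorems/SawtoothPulseCascadeK3NonlinearClosureStubScalarVelocityStability.lean`), cited: `L²`-stability of classical scalar transport under a drift perturbation — the body of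
`ScalarVelocityStability` spelled out (it is the tree theorem `Torus.IsClassicalScalarTransportOn.scalarVelocityStability`
at `d = Fin 2`). -/
theorem stub_scalarVelocityStability :
    ∀ (S : Set ℝ) (κ T : ℝ) (u v : ℝ → UnitAddTorus (Fin 2) → EuclideanSpace ℝ (Fin 2))
      (θ ζ : ℝ → UnitAddTorus (Fin 2) → ℝ) (G : ℝ → ℝ),
      0 ≤ κ → 0 ≤ T → Convex ℝ S → Icc 0 T ⊆ S →
      FluidPDE.Torus.IsClassicalScalarTransportOn S κ u θ → FluidPDE.Torus.IsClassicalScalarTransportOn S κ v ζ →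
      θ 0 = ζ 0 →
      (∀ t ∈ Icc 0 T, ∀ x, ‖FunctionSpaces.Torus.gradient (θ t) x‖ ≤ G t) →
      IntervalIntegrable (fun t => Real.sqrt (FluidPDE.Torus.vectorL2Sq (u t - v t)) * G t) volume 0 T →
      |FluidPDE.Torus.scalarL2Sq (θ T) - FluidPDE.Torus.scalarL2Sq (ζ T)| ≤
        2 * Real.sqrt (FluidPDE.Torus.scalarL2Sq (θ 0)) *
          ∫ t in (0 : ℝ)..T, Real.sqrt (FluidPDE.Torus.vectorL2Sq (u t - v t)) * G t :=
  Summit.AnomalousDissipation.AnomalousDissipation.Theorems.SawtoothPulseCascade.K3NonlinearClosureLocalised.stub_scalarVelocityStability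

/-- STUB S2b (M) — LANDED p794319 (`Theorems/SawtoothPulseCascadeK3NonlinearClosureStubShearGradientEnvelope.lean`), cited: the sup-gradient envelope across one pulse — the body of `ShearGradientEnvelope` spelled out
(maximum principle for `∂ᵢθ` with a shear source, `PassiveScalarGradientTransport`, on the single-shear half-slots
of `SawtoothCascade` Part 9–10). -/
theorem stub_shearGradientEnvelope :
    ∀ (P : CascadeParams) (κ : ℝ) (j : ℕ) (S : Set ℝ) (w : ℝ → UnitAddTorus (Fin 2) → ℝ),
      0 ≤ κ → 0 ≤ P.γ → 0 < P.δ₀ → 1 ≤ P.d → Convex ℝ S →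
      Icc (CascadeParams.tStart j) (CascadeParams.tStart (j + 1)) ⊆ S →
      FluidPDE.Torus.IsClassicalScalarTransportOn S κ P.field w →
      ((⨆ x, |FunctionSpaces.Torus.gradient (w (CascadeParams.tStart j + CascadeParams.tHalf j)) x 0|) ≤
          ⨆ x, |FunctionSpaces.Torus.gradient (w (CascadeParams.tStart j)) x 0|) ∧
      ((⨆ x, |FunctionSpaces.Torus.gradient (w (CascadeParams.tStart j + CascadeParams.tHalf j)) x 1|) ≤
          (⨆ x, |FunctionSpaces.Torus.gradient (w (CascadeParams.tStart j)) x 1|) +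
            P.γ * ⨆ x, |FunctionSpaces.Torus.gradient (w (CascadeParams.tStart j)) x 0|) ∧
      ((⨆ x, |FunctionSpaces.Torus.gradient (w (CascadeParams.tStart (j + 1))) x 1|) ≤
          ⨆ x, |FunctionSpaces.Torus.gradient (w (CascadeParams.tStart j + CascadeParams.tHalf j)) x 1|) ∧
      ((⨆ x, |FunctionSpaces.Torus.gradient (w (CascadeParams.tStart (j + 1))) x 0|) ≤
          (⨆ x, |FunctionSpaces.Torus.gradient (w (CascadeParams.tStart j + CascadeParams.tHalf j)) x 0|) +
            P.γ * ⨆ x, |FunctionSpaces.Torus.gradient (w (CascadeParams.tStart j + CascadeParams.tHalf j)) x 1|) :=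
  Summit.AnomalousDissipation.AnomalousDissipation.Theorems.SawtoothPulseCascade.K3NonlinearClosureLocalised.stub_shearGradientEnvelope

/-- STUB S2c — LANDED p799028 (`Theorems/SawtoothPulseCascadeK3NonlinearClosureStubHalfPulseEnergyBound.lean`), cited:
the crude half-pulse energy bound for the WEAK `A = 1` class (every weak passive vector about the time-shifted
carrier grows in `L²` by at most `e^{γ}` over one half pulse, UNIFORMLY in `ν`), proved WITHOUT weak-class
uniqueness: the Galerkin identity run on the weak solution itself gives the ν-uniform energy inequality with the
production bounded through the carrier's strain (`…WeakEnergyGrowth.lean`, p798498), the datum is Leray-reduced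
(orthogonal projection onto the closed span of smooth divergence-free fields), and on each half slot the cascade
shear has production `≤ ½ rate ‖v‖²` with `∫ rate ≤ γ`. -/
theorem stub_halfPulseEnergyBound : ∀ P : CascadeParams, HalfPulseEnergyBound P :=
  Summit.AnomalousDissipation.AnomalousDissipation.Theorems.SawtoothPulseCascade.K3NonlinearClosureLocalised.stub_halfPulseEnergyBound

/-- STUB S3 (XL — the real K1), RESHAPE r7 (leafhand-ad-sawtoothpulsecasca-2 g1): restricted to the sub-box
`γ ∈ [5, 8]` that the composition actually consumes (glue point `(5, 2)`), and spelled out in tree vocabulary.  On this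
sub-box it is EXACTLY the route's open crux K1loc (stmt-AnomalousDissipation-19491, rate `γ² − 3`) pushed through the
window arithmetic — LANDED reduction `K3NonlinearClosureLocalised.k1LocalisedInWindow58_of_cruxRate` (p795336): the
moment 19491 lands, `stub_k1Localised := k1LocalisedInWindow58_of_cruxRate (fun γ hγ ρN hρ => (h19491 γ hγ ρN hρ).2)`.
Why it might fail: as 19491 (bulk rate below the window floor; straggler drain). -/
theorem stub_k1Localised :
    ∀ γ ∈ Icc (5 : ℝ) 8, ∀ ρN : ℕ, ρN ∈ Finset.Icc 2 7 → ∃ r : ℝ, 1 < r ∧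
      max (ρN : ℝ) (3 * Real.exp (sawSigmaStar * γ)) * (γ ^ 2 + 2) < r ^ 2 ∧
        K1Localised ⟨γ, 1 / 4, 2, 1, ρN⟩ r := by
  sorry

/-- STUB S4 (XL — consumes K2″), RESHAPE r7: restricted to the sub-box `γ ∈ [5, 8]` and spelled out in tree
vocabulary (the body of `PlanarSlaving ⟨γ,¼,2,1,ρN⟩ r`): planar slaving of the TRUE planar Navier–Stokes solution up to
the horizon of every admissible rate.  Why it might fail: the continuous-in-time residual creation and the nonlinear /
residual×residual sources are not comb-class data injected at `tInject`; their Duhamel superposition must be re-aligned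
(backward heat over ≤ one half pulse) and the general-data bound `e^{γ}` per pulse (S2c, landed) beaten by the relative
smallness `(max(ρN,3e^{σ⋆γ})(γ²+2)/r²)^{J}` up to the horizon.  Crux-sized (the pointwise-in-phase analogue of the
route's `ApproxSol58`, which controls a Grenier approximate solution instead of `V_ν` itself). -/
theorem stub_planarSlaving :
    (∀ P : CascadeParams, HalfPulseEnergyBound P) → K2LinearisedCascadeGrowth →
    ∀ γ ∈ Icc (5 : ℝ) 8, ∀ ρN : ℕ, ρN ∈ Finset.Icc 2 7 → ∀ r : ℝ, 1 < r →
      max (ρN : ℝ) (3 * Real.exp (sawSigmaStar * γ)) * (γ ^ 2 + 2) < r ^ 2 →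
      ∀ A : ℕ, ∃ ν₀ : ℝ, 0 < ν₀ ∧ ∃ K : ℝ, ∀ ν ∈ Ioc 0 ν₀,
        ∀ (V : ℝ → UnitAddTorus (Fin 2) → EuclideanSpace ℝ (Fin 2)) (φ : ℝ → UnitAddTorus (Fin 2) → ℝ),
          FunctionSpaces.Torus.IsClassicalNSSolutionOn (Ico (0 : ℝ) 1) ν (planarForce ⟨γ, 1 / 4, 2, 1, ρN⟩) V φ →
          V 0 = 0 →
          ∀ j ≤ Jrate r ν + A, ∀ t ∈ Icc (CascadeParams.tStart j) (CascadeParams.tStart (j + 1)),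
            Real.sqrt (FluidPDE.Torus.vectorL2Sq (V t - CascadeParams.field ⟨γ, 1 / 4, 2, 1, ρN⟩ t)) ≤
              K * ν * ∑ i ∈ Finset.range (j + 1),
                (CascadeParams.N ⟨γ, 1 / 4, 2, 1, ρN⟩ i : ℝ) / Real.sqrt (CascadeParams.δ ⟨γ, 1 / 4, 2, 1, ρN⟩ i) *
                  (max (ρN : ℝ) (3 * Real.exp (sawSigmaStar * γ))) ^ (j - i) := by
  sorry

/-- STUB S5 (L) — LANDED p795074 (`Theorems/SawtoothPulseCascadeK3NonlinearClosureStubLocalisedClosure.lean`), cited. RESHAPE r4: stated PER PARAMETER POINT of the box in tree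
vocabulary (`K1Localised`, `DriftFree.Existence`, the body of `PlanarSlaving`, `DriftFree.PlanarAnomalousFamily`), the
toolkit hypotheses S2a/S2b dropped (they are landed THEOREMS, p794233/p794319, so as hypotheses they were vacuous).
Content unchanged: inside the window, K1loc with rate `r`, existence for fixed `ν` and planar slaving up to the
horizon `J_r(ν)+A` give the planar anomalous family.  Repair path of record: `PlanarSlaving ⇒ DriftFree.ApproximateSolution`
with the trivial witness `U := V_ν` (`Theorems…ApproxOfSlaving`), then the LANDED drift-free closure
`DriftFreeClosure.planarAnomalousFamily_of`. -/
theorem stub_localisedClosure :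
    ∀ (P : CascadeParams) (r : ℝ), P.δ₀ = 1 / 4 → P.d = 2 → P.N₀ = 1 → P.γ ∈ Icc (4 : ℝ) 8 → 2 ≤ P.ρN → P.ρN ≤ 7 →
      1 < r → max (P.ρN : ℝ) (3 * Real.exp (sawSigmaStar * P.γ)) * (P.γ ^ 2 + 2) < r ^ 2 →
      K1Localised P r → Existence P →
      (∀ A : ℕ, ∃ ν₀ : ℝ, 0 < ν₀ ∧ ∃ K : ℝ, ∀ ν ∈ Ioc 0 ν₀,
        ∀ (V : ℝ → UnitAddTorus (Fin 2) → EuclideanSpace ℝ (Fin 2)) (φ : ℝ → UnitAddTorus (Fin 2) → ℝ),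
          FunctionSpaces.Torus.IsClassicalNSSolutionOn (Ico (0 : ℝ) 1) ν (planarForce P) V φ → V 0 = 0 →
          ∀ j ≤ Jrate r ν + A, ∀ t ∈ Icc (CascadeParams.tStart j) (CascadeParams.tStart (j + 1)),
            Real.sqrt (FluidPDE.Torus.vectorL2Sq (V t - P.field t)) ≤
              K * ν * ∑ i ∈ Finset.range (j + 1),
                (P.N i : ℝ) / Real.sqrt (P.δ i) * (max (P.ρN : ℝ) (3 * Real.exp (sawSigmaStar * P.γ))) ^ (j - i)) →
      PlanarAnomalousFamily P :=
  Summit.AnomalousDissipation.AnomalousDissipation.Theorems.SawtoothPulseCascade.K3NonlinearClosureLocalised.stub_localisedClosure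

/-! ## Composition (kernel-checked, no sorry outside the stubs). -/

/-- The crux K3′ BY NAME from the registered stubs, applied by name at the glue point `(γ, ρN) = (5, 2)` (RESHAPE r7:
the point moved from `(4,2)` to `(5,2)`, inside the sub-box `[5,8]` of S3/S4 where S3 is the route's crux K1loc); the
hypothesis `K1BoundedStrainCascade` of K3′ is not used — S3 supersedes it. -/
theorem K3NonlinearClosure_of : K3NonlinearClosure := by
  intro _hK1 hK2
  obtain ⟨hreg, hlift, hex⟩ := stub_packaging
  have h5 : (5 : ℝ) ∈ Icc (5 : ℝ) 8 := ⟨le_rfl, by norm_num⟩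
  have h48 : (5 : ℝ) ∈ Icc (4 : ℝ) 8 := ⟨by norm_num, by norm_num⟩
  have h2' : (2 : ℕ) ∈ Finset.Icc 2 7 := by simp
  obtain ⟨r, hr1, hwin, hK1⟩ := stub_k1Localised 5 h5 2 h2'
  have hPS := stub_planarSlaving stub_halfPulseEnergyBound hK2 5 h5 2 h2' r hr1 hwin
  have hfam : PlanarAnomalousFamily ⟨5, 1 / 4, 2, 1, 2⟩ :=
    stub_localisedClosure ⟨5, 1 / 4, 2, 1, 2⟩ r rfl rfl rfl h48 le_rfl (by norm_num) hr1 hwin hK1 (hex 5 h48 2 h2') hPS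
  obtain ⟨hdat, hfs, hhold⟩ := hreg 5 h48 2 h2'
  obtain ⟨ν, hν, V, φ, R, hm, hAD⟩ := hfam
  refine ⟨ν, liftedDatum, liftedForce ⟨5, 1 / 4, 2, 1, 2⟩, fun m t => twoHalf (V m t) (R m t),
    fun m t => φ m t ∘ planarProj, hν, hdat, hhold, hfs, fun m => ⟨?_, ?_, (hm m).2.2.2.2⟩, hAD⟩
  · exact hlift _ _ _ _ _ (hm m).1 (hm m).2.2.1
  · show twoHalf (V m 0) (R m 0) = liftedDatum
    rw [(hm m).2.1, (hm m).2.2.2.1]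
    rfl

/-- S3 (sub-box form) from the route's crux K1loc (stmt-AnomalousDissipation-19491), by the landed reduction
`k1LocalisedInWindow58_of_cruxRate` (no sorry beyond the crux). -/
theorem stub_k1Localised_of_K1LocalisedCascade (h : K1LocalisedCascade) :
    ∀ γ ∈ Icc (5 : ℝ) 8, ∀ ρN : ℕ, ρN ∈ Finset.Icc 2 7 → ∃ r : ℝ, 1 < r ∧
      max (ρN : ℝ) (3 * Real.exp (sawSigmaStar * γ)) * (γ ^ 2 + 2) < r ^ 2 ∧
        K1Localised ⟨γ, 1 / 4, 2, 1, ρN⟩ r :=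
  Summit.AnomalousDissipation.AnomalousDissipation.Theorems.SawtoothPulseCascade.K3NonlinearClosureLocalised.k1LocalisedInWindow58_of_cruxRate
    fun γ hγ ρN hρ => (h γ hγ ρN hρ).2

/-- Bonus (no sorry beyond S3): the route's K1 item `K1BoundedStrainCascade`'s fixed-fraction conjunct follows from S3. -/
theorem k1FixedFraction_of_S3 (h₃ : K1LocalisedInWindow) :
    ∀ γ ∈ Icc (4 : ℝ) 8, ∀ ρN ∈ Finset.Icc 2 7, K1FixedFraction ⟨γ, 1 / 4, 2, 1, ρN⟩ := by
  intro γ hγ ρN hρ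
  obtain ⟨r, -, -, hr⟩ := h₃ γ hγ ρN hρ
  exact K1FixedFraction_of_K1Localised _ _ hr

end Summit.AnomalousDissipation.AnomalousDissipation.Cruxes.K3NonlinearClosure.Localised
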